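import Mathlib
import Summits.CriticalPhenomena.SAWScalingLimit.Theses.SAWLeftRightFKG
import Literature.Probability.RandomPlanarGeometry.SAWBridgeUpperBound
import Literature.Probability.RandomPlanarGeometry.SelfAvoidingWalkProofs

/-!
# Sketch (crux-ideate, ideator 2, round 1) — first lemmas for the idea cards on
# `SAWLeftRightFKG.LeftRightFKG` (stmt-CriticalPhenomena-11232)

Card A `union-fibre-harris`   : fibre decomposition of the PA covariance over double-chord unions;
                                coherent fibres are cubes and Harris-positive; frustration = order inversion.
Card B `kesten-cone-certificate`: de-transcendentalised crux `KestenConePA` (PA at every fugacity `x`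
                                with `b_n x^n ≤ 1` for `n ≤` the longest chord) and soundness of
                                certificates in the cone of Kesten's bridge inequalities.
Nothing here is a proof obligation of the route; `sorry` marks statements to be proved on a line.
-/

open scoped BigOperators Classical
open MeasureTheory Literature.Probability.LatticeModels Literature.Probability.RandomPlanarGeometry

namespace Summit.CriticalPhenomena.SAWScalingLimit.Cruxes.LeftRightFKG.SketchIdeator2

/-! ## The crux at a general fugacity `x` -/

/-- Fugacity-`x` weight on chords (`weightAt x_c = SAW.weight` by `rfl`). -/
noncomputable def weightAt (x : ℝ) (Ω : Set ℂ) (δ : ℝ) (a b : Site 2) : Measure (SAW.DomainSAW Ω δ a b) :=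
  Measure.sum fun γ => ENNReal.ofReal (x ^ γ.length) • Measure.dirac γ

theorem weightAt_criticalFugacity (Ω : Set ℂ) (δ : ℝ) (a b : Site 2) :
    weightAt SAW.criticalFugacity Ω δ a b = SAW.weight Ω δ a b := rfl

/-- `LRPAAtUpTo x N`: the crux statement VERBATIM, with the critical weight replaced by `weightAt x`
and restricted to domain data all of whose chords have length `≤ N`. -/
def LRPAAtUpTo (x : ℝ) (N : ℕ) : Prop :=
  ∀ (δ : ℝ) (c a b a' b' : Site 2) (C : (zdGraph 2).Walk c c),
  let Ω : Set ℂ := {z | Literature.Topology.PlaneTopology.wind (fun t : ℝ => Set.IccExtend zero_le_one (C.toCurve (meshPoint δ)) t - z) ≠ 0}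
  let le : SAW.DomainSAW Ω δ a b → SAW.DomainSAW Ω δ a b → Prop := fun γ₁ γ₂ => ∀ z : ℂ, 0 ≤ Literature.Topology.PlaneTopology.wind (fun t : ℝ => Set.IccExtend zero_le_one ((γ₁.walk.append γ₂.walk.reverse).toCurve (meshPoint δ)) t - z)
  0 < δ → a' ∈ C.support → b' ∈ C.support → (zdGraph 2).Adj a a' → (zdGraph 2).Adj b b' →
  (∀ γ : SAW.DomainSAW Ω δ a b, γ.length ≤ N) →
  ∀ A B : Set (SAW.DomainSAW Ω δ a b), (∀ γ₁ γ₂, le γ₁ γ₂ → γ₁ ∈ A → γ₂ ∈ A) → (∀ γ₁ γ₂, le γ₁ γ₂ → γ₁ ∈ B → γ₂ ∈ B) →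
  weightAt x Ω δ a b A * weightAt x Ω δ a b B ≤ weightAt x Ω δ a b Set.univ * weightAt x Ω δ a b (A ∩ B)

/-! ## Card B: Kesten-cone hypothesis, the transfer `KestenConePA`, soundness of certificates -/

/-- Bridge pressure hypothesis `𝔅_N(x)`: `0 ≤ x` and `b_n x^n ≤ 1` for `1 ≤ n ≤ N`
(`SAW.bridgeCount n = b_n`, the `ℤ²` bridge count of the tree). -/
def BridgePressure (x : ℝ) (N : ℕ) : Prop :=
  0 ≤ x ∧ ∀ n : ℕ, 1 ≤ n → n ≤ N → (SAW.bridgeCount n : ℝ) * x ^ n ≤ 1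

/-- `𝔅_N(x_c)` for every `N`: `b_n ≤ μ^n` (tree: `SAW.bridgeCount_le_pow`) and `x_c = μ⁻¹`. -/
theorem bridgePressure_criticalFugacity (N : ℕ) : BridgePressure SAW.criticalFugacity N := by
  refine ⟨SAW.criticalFugacity_pos_lt_one'.1.le, fun n _ _ => ?_⟩
  have hμ : 0 < SAW.connectiveConstant := by
    have := SAW.criticalFugacity_pos_lt_one'.1
    simp only [SAW.criticalFugacity, inv_pos] at this
    exact this
  have hb := SAW.bridgeCount_le_pow n
  have hx : SAW.criticalFugacity ^ n = (SAW.connectiveConstant ^ n)⁻¹ := by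
    simp [SAW.criticalFugacity, inv_pow]
  rw [hx]
  have hpos : 0 < SAW.connectiveConstant ^ n := pow_pos hμ n
  calc (SAW.bridgeCount n : ℝ) * (SAW.connectiveConstant ^ n)⁻¹
      ≤ SAW.connectiveConstant ^ n * (SAW.connectiveConstant ^ n)⁻¹ := by gcongr
    _ = 1 := mul_inv_cancel₀ hpos.ne'

/-- TRANSFER `C⁺` (card B): positive association at EVERY fugacity `x` satisfying the bridge pressure
hypothesis up to the length of the longest chord.  `μ` no longer appears: each instance is a finite
family of polynomial inequalities over `ℚ[x]`. -/
def KestenConePA : Prop :=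
  ∀ (x : ℝ) (N : ℕ), BridgePressure x N → LRPAAtUpTo x N

/-- `C⁺ ⇒ crux`: take `N :=` the longest chord of the (finite) domain and `x := x_c`
(`bridgePressure_criticalFugacity`).  The only non-bookkeeping input is finiteness of
`SAW.DomainSAW Ω δ a b` for `δ > 0` and the bounded lattice domain `Ω = {wind(C,·) ≠ 0}`. -/
theorem leftRightFKG_of_kestenConePA (h : KestenConePA) :
    Summit.CriticalPhenomena.SAWScalingLimit.Theses.SAWLeftRightFKG.LeftRightFKG := by
  sorry

/-- SOUNDNESS OF KESTEN-CONE CERTIFICATES (card B, first lemma): a polynomial lying in the cone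
generated over `ℝ₊[x]` by the Kesten generators `1 - b_n X^n` (`1 ≤ n ≤ N`) is nonnegative wherever
`𝔅_N(x)` holds — in particular at `x_c`.  (Products of generators, i.e. multi-bridge extraction,
are the Handelman extension; same proof.) -/
theorem kestenCone_sound {x : ℝ} {N : ℕ} (hB : BridgePressure x N) (D : Polynomial ℝ)
    (σ : ℕ → Polynomial ℝ) (hσ : ∀ n k, 0 ≤ (σ n).coeff k)
    (hD : D = σ 0 + ∑ n ∈ Finset.Icc 1 N, σ n * (1 - Polynomial.C (SAW.bridgeCount n : ℝ) * Polynomial.X ^ n)) :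
    0 ≤ D.eval x := by
  have hx : 0 ≤ x := hB.1
  have hσeval : ∀ n, 0 ≤ (σ n).eval x := fun n => by
    rw [Polynomial.eval_eq_sum_range]
    exact Finset.sum_nonneg fun k _ => mul_nonneg (hσ n k) (pow_nonneg hx k)
  subst hD
  rw [Polynomial.eval_add, Polynomial.eval_finsetSum]
  refine add_nonneg (hσeval 0) (Finset.sum_nonneg fun n hn => ?_)
  rw [Finset.mem_Icc] at hn
  rw [Polynomial.eval_mul]
  refine mul_nonneg (hσeval n) ?_
  simp only [Polynomial.eval_sub, Polynomial.eval_one, Polynomial.eval_mul, Polynomial.eval_C,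
    Polynomial.eval_pow, Polynomial.eval_X, sub_nonneg]
  exact hB.2 n hn.1 hn.2

/-! ## Card A: union fibres, antiparallel contact, the Harris lemma on distributive fibres -/

section Fibre

variable {Ω : Set ℂ} {δ : ℝ} {a b : Site 2}

/-- Two chords are in ANTIPARALLEL CONTACT if some lattice edge is traversed by `γ₁` in one
direction and by `γ₂` in the other (a dart of `γ₁` whose reverse is a dart of `γ₂`). -/
def Antiparallel (γ₁ γ₂ : SAW.DomainSAW Ω δ a b) : Prop :=
  ∃ d ∈ γ₁.walk.darts, d.symm ∈ γ₂.walk.darts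

/-- Ordered pairs of chords lie in the same UNION FIBRE iff the edge multisets of `γ₁ + γ₂` agree. -/
def SameFibre (p q : SAW.DomainSAW Ω δ a b × SAW.DomainSAW Ω δ a b) : Prop :=
  (p.1.walk.edges : Multiset (Sym2 (Site 2))) + (p.2.walk.edges : Multiset (Sym2 (Site 2)))
    = (q.1.walk.edges : Multiset (Sym2 (Site 2))) + (q.2.walk.edges : Multiset (Sym2 (Site 2)))

/-- The x-FREE signed fibre count `S_G(U,V) = Σ_{(γ,γ') ∈ G} 1_U(γ) (1_V(γ) - 1_V(γ'))` of the fibre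
`G` of `p` (a `finsum`; the fibre is finite for `δ > 0`). -/
noncomputable def fibreSum (U V : Set (SAW.DomainSAW Ω δ a b))
    (p : SAW.DomainSAW Ω δ a b × SAW.DomainSAW Ω δ a b) : ℝ :=
  ∑ᶠ q : {q : SAW.DomainSAW Ω δ a b × SAW.DomainSAW Ω δ a b // SameFibre p q},
    (U.indicator 1 q.1.1 : ℝ) * ((V.indicator 1 q.1.1 : ℝ) - (V.indicator 1 q.1.2 : ℝ))

/-- Two chords are COHERENT if their common vertices are met in the same order along both. -/
def Coherent (γ₁ γ₂ : SAW.DomainSAW Ω δ a b) : Prop :=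
  ∀ u v : Site 2, u ∈ γ₁.walk.support → v ∈ γ₁.walk.support → u ∈ γ₂.walk.support → v ∈ γ₂.walk.support →
    (γ₁.walk.support.idxOf u ≤ γ₁.walk.support.idxOf v ↔ γ₂.walk.support.idxOf u ≤ γ₂.walk.support.idxOf v)

/-- LEMMA-TO-BE (card A, the first checkable statement of the line): a COHERENT pair spans a union fibre
that is a Boolean cube of pocket assignments, on which the complement chord is the cube complement;
hence its signed count is nonnegative for every pair of up-sets of the left–right order (`le` is any
relation here; on the line it is the crux's lens-winding order = region inclusion).  Provable from
`fibre_harris` below once COHERENT-FIBRE = CUBE is established.  Census (ideator-2 folder, py/):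
holds for all 3 499 + 43 509 coherent fibres of the 4×4- and 5×4-vertex boxes, while EVERY incoherent
fibre there (9 810 + 281 277) is frustrated for some pair of face events — so coherence, not absence of
antiparallel contact, is the right hypothesis (`Antiparallel` is kept only as vocabulary). -/
def CoherentPositivity (le : SAW.DomainSAW Ω δ a b → SAW.DomainSAW Ω δ a b → Prop) : Prop :=
  ∀ (U V : Set (SAW.DomainSAW Ω δ a b)),
    (∀ γ₁ γ₂, le γ₁ γ₂ → γ₁ ∈ U → γ₂ ∈ U) → (∀ γ₁ γ₂, le γ₁ γ₂ → γ₁ ∈ V → γ₂ ∈ V) →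
    ∀ p : SAW.DomainSAW Ω δ a b × SAW.DomainSAW Ω δ a b, Coherent p.1 p.2 → 0 ≤ fibreSum U V p

end Fibre

/-- HARRIS ON A DISTRIBUTIVE FIBRE (card A, proved core; abstract form): on a finite distributive
lattice with an order-reversing involution `bar` (the complement chord), for up-sets `U, V`:
`#{ξ ∈ U : bar ξ ∈ V} ≤ #(U ∩ V)`.  Hence `S_G(U,V) = #(U∩V) - #{ξ ∈ U : bar ξ ∈ V} ≥ 0` for every
fibre whose poset is distributive — coherent fibres are the Boolean cubes `{0,1}^m`.
Proof sketch: Daykin `#U·#V ≤ #(U ⊼ V)·#(U ⊻ V) ≤ #L·#(U∩V)` and, with the down-set `D = bar(V)`,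
`#L·#(U ∩ D) ≤ #U·#D = #U·#V` (Mathlib `Finset.le_card_infs_mul_card_sups`). -/
theorem fibre_harris {L : Type*} [Fintype L] [DecidableEq L] [DistribLattice L]
    (bar : L → L) (hbar : Antitone bar) (hinv : Function.Involutive bar)
    (U V : Finset L) (hU : IsUpperSet (U : Set L)) (hV : IsUpperSet (V : Set L)) :
    (U.filter fun ξ => bar ξ ∈ V).card ≤ (U ∩ V).card := by
  sorry

end Summit.CriticalPhenomena.SAWScalingLimit.Cruxes.LeftRightFKG.SketchIdeator2
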